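import Literature.NumberTheory.QuadraticFields.ZsqrtdFormClassGroupProofs
import Mathlib.GroupTheory.Perm.Cycle.Type
import HarnessLib

/-!
# The class number `h(-4p)` is odd for a prime `p ≡ 3 (mod 4)`; a bound for `#C(ℤ[√d])`

Topic `NumberTheory/QuadraticFields`; proofs-only continuation (theorems only, no definition, no
named fact) of `ZsqrtdFormClassGroup.lean` / `ZsqrtdFormClassGroupProofs.lean` (Cox, *Primes of
the form x² + ny²*, Thm. 7.7 for the order `ℤ[√d]`: labels = reduced primitive positive definite
forms of discriminant `4d` ↔ `ClassGroup (ℤ√d)`, `cox_formClassGroup_holds`). We prove: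

* `toClass_neg_b` — the class of the **opposite form** `(a, -b, c)` is the inverse of the class of
  `(a, b, c)` (Cox, Thm. 3.9, "its opposite is `f'(x,y) = ax² - bxy + cy²`" gives the inverse; here
  through Cox (7.6): `𝔞_f · 𝔞_{f'} = (a)`, the tree's `span_pair_mul_span_pair_neg`);
* `eq_one_of_inv_eq_self` — for a prime `p ≡ 3 (mod 4)`, **`C(ℤ[√-p])` has no element of order
  `2`**: by Cox, Lemma 3.10 a reduced form `(a, b, c)` of discriminant `D` has order `≤ 2` iff
  `b = 0`, `a = b` or `a = c`; for `D = -4p` the only *primitive* such form is the principal form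
  `(1, 0, p)` (`b = 0` forces `ac = p`; `a = b` forces `(2, 2, (p+1)/2)`, imprimitive as
  `4 ∣ p + 1`; `a = c` forces `((p+1)/2, p-1, (p+1)/2)`, reduced only for `p = 3` where it is
  `(2, 2, 2)`) — the case `n = p ≡ 3 (mod 4)`, `r = 1`, `μ = r = 1` of Cox, Prop. 3.11 ("the class
  group `C(D)` has exactly `2^{μ-1}` elements of order `≤ 2`");
* `odd_card_classGroup_neg_prime` — hence **`#C(ℤ[√-p]) = h(-4p)` is odd** (Cauchy's theorem);
* `classNumber_le`, `card_classGroup_zsqrtd_le` — the crude bound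
  `#C(ℤ[√d]) = h(4d) ≤ (|4d| + 1)(2|4d| + 1)` from the enumeration `reducedFormsList` of the tree
  (every reduced form is a `candidate`).

These feed the discharge of `Literature.Computability.Cryptography.Csidh.jmv_smallPrimesGenerate`
(`Computability/Cryptography/CsidhGenerators.lean`): the characters of `cl(ℤ[√-p])` have odd
order, so their class fields are tamely ramified at `2`.

## References

* [Cox2013] D. A. Cox, *Primes of the form x² + ny²*, 2nd ed., Wiley 2013: §3.A Thm. 3.9 (the
  opposite form is the inverse), §3.B **Lemma 3.10** and **Prop. 3.11** (PDF pp. 72–73 of the held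
  copy), §7.A (7.6), §7.B Thm. 7.7.
-/

noncomputable section

open scoped nonZeroDivisors Classical

namespace Literature.NumberTheory.QuadraticFields.Quadratic.BinQF

variable {d : ℤ}

/-! ### The opposite form `(a, -b, c)` and the inverse class -/

/-- The opposite form `(a, -b, c)` of a primitive positive definite form of discriminant `D` is
primitive positive definite of discriminant `D`. [cite: Cox2013, §3.A Thm. 3.9] -/
theorem isPosPrim_neg_b {D : ℤ} {f : BinQF} (hf : f.IsPosPrim D) :
    (⟨f.a, -f.b, f.c⟩ : BinQF).IsPosPrim D := by
  refine ⟨?_, hf.a_pos, ?_⟩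
  · rw [← hf.disc_eq, disc, disc]
    ring
  · have := hf.primitive
    unfold IsPrimitive at this ⊢
    simpa using this

variable [IsDomain (ℤ√d)]

/-- **The opposite form represents the inverse class**: for a primitive positive definite form
`f = (a, b, c)` of discriminant `4d`, `toClass (a, -b, c) = (toClass f)⁻¹` in `ClassGroup (ℤ√d)`,
because `𝔞_f · 𝔞_{(a,-b,c)} = (a, -β + √d)(a, β + √d) = (a)` is principal (Cox (7.6), `b = 2β`).
[cite: Cox2013, §3.A Thm. 3.9 with §7.A (7.6)] -/
theorem toClass_neg_b {f : BinQF} (hf : f.IsPosPrim (4 * d)) :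
    toClass d ⟨f.a, -f.b, f.c⟩ = (toClass d f)⁻¹ := by
  set g : BinQF := ⟨f.a, -f.b, f.c⟩ with hg
  have hgp : g.IsPosPrim (4 * d) := isPosPrim_neg_b hf
  obtain ⟨β, hb, hd⟩ := exists_b_eq_two_mul hf.disc_eq
  have hbg : g.b = 2 * (-β) := by simp [hg, hb]
  obtain ⟨x, y, z, hxyz⟩ := exists_combination_of_isPrimitive hf.primitive
  have hprod : ideal d f * ideal d g = Ideal.span {(f.a : ℤ√d)} := by
    rw [ideal_eq_span_pair hb, ideal_eq_span_pair hbg]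
    exact span_pair_mul_span_pair_neg hd ⟨x, y, z, by rw [← hxyz, hb]⟩
  have hfu : IsUnit (fracIdeal d f) := isUnit_fracIdeal_of_isPosPrim hf
  have hgu : IsUnit (fracIdeal d g) := isUnit_fracIdeal_of_isPosPrim hgp
  have ha0 : (f.a : ℤ√d) ≠ 0 := by exact_mod_cast hf.a_pos.ne'
  have hunit : IsUnit (fracIdeal d f * fracIdeal d g) := hfu.mul hgu
  rw [toClass_of_isUnit hfu, toClass_of_isUnit hgu, eq_inv_iff_mul_eq_one, ← map_mul]
  have hu : hgu.unit * hfu.unit = hunit.unit :=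
    Units.ext (by simp only [Units.val_mul, IsUnit.unit_spec]; exact mul_comm _ _)
  rw [hu, ClassGroup.mk_eq_one_of_coe_ideal (I' := ideal d f * ideal d g)
    (by rw [IsUnit.unit_spec, fracIdeal, fracIdeal, FractionalIdeal.coeIdeal_mul])]
  exact ⟨f.a, ha0, hprod⟩

omit [IsDomain (ℤ√d)] in
/-- The opposite of a reduced form is reduced, unless `b > 0` and (`b = a` or `a = c`) — the
boundary cases of Cox, Lemma 3.10. [cite: Cox2013, §3.B Lemma 3.10] -/
theorem isReduced_neg_b_or {f : BinQF} (hr : f.IsReduced) :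
    (⟨f.a, -f.b, f.c⟩ : BinQF).IsReduced ∨ (0 < f.b ∧ (f.b = f.a ∨ f.a = f.c)) := by
  obtain ⟨h1, h2, h3⟩ := hr
  by_cases hb : 0 < f.b ∧ (f.b = f.a ∨ f.a = f.c)
  · exact Or.inr hb
  · refine Or.inl ⟨by simpa using h1, h2, ?_⟩
    rintro (h | h)
    · simp only [abs_neg] at h
      by_contra hneg
      have hpos : 0 < f.b := by simp only [neg_nonneg, not_le] at hneg; exact hneg
      exact hb ⟨hpos, Or.inl (by rw [← h, abs_of_pos hpos])⟩
    · by_contra hneg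
      have hpos : 0 < f.b := by simp only [neg_nonneg, not_le] at hneg; exact hneg
      exact hb ⟨hpos, Or.inr h⟩

omit [IsDomain (ℤ√d)] in
/-- A product `u * v` of integers `u, v ≥ 2` is not a (natural) prime. [folklore] -/
theorem not_prime_of_mul_eq {u v : ℤ} {p : ℕ} (hu : 2 ≤ u) (hv : 2 ≤ v) (h : u * v = p) :
    ¬ p.Prime := by
  intro hp
  lift u to ℕ using (by omega) with u' hu'
  lift v to ℕ using (by omega) with v' hv'
  have h' : u' * v' = p := by exact_mod_cast h
  rw [← h', Nat.prime_mul_iff] at hp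
  rcases hp with ⟨-, h1⟩ | ⟨-, h1⟩ <;> omega

omit [IsDomain (ℤ√d)] in
/-- **No primitive reduced form of discriminant `-4p` (`p ≡ 3 (mod 4)` prime) lies on the
boundary `b = a > 0` or `a = c, b > 0`** of Cox's Lemma 3.10: `b = a` gives `a(4c - a) = 4p`,
whence `(a, b, c) = (2, 2, (p+1)/2)` with `(p+1)/2` even; `a = c` gives `(a - β)(a + β) = p`
(`b = 2β`), whence `b = p - 1 ≤ a = (p+1)/2`, `p = 3` and `(a, b, c) = (2, 2, 2)`; neither is
primitive. [cite: Cox2013, §3.B Lemma 3.10 and Prop. 3.11] -/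
theorem not_boundary_of_isLabel_neg_prime {p : ℕ} (hp : p.Prime) (hp4 : p % 4 = 3) {f : BinQF}
    (hf : f.IsPosPrim (4 * -(p : ℤ))) (hr : f.IsReduced) (hb0 : 0 < f.b)
    (hbd : f.b = f.a ∨ f.a = f.c) : False := by
  have ha := hf.a_pos
  obtain ⟨h1, h2, -⟩ := hr
  have hdisc := hf.disc_eq
  simp only [disc] at hdisc
  have hprim := (isPrimitive_iff f).1 hf.primitive 2
  have h2unit : ¬ IsUnit (2 : ℤ) := by decide
  rcases hbd with hba | hac
  · -- `b = a`: `a (4c - a) = 4p`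
    have hb2 : (2 : ℤ) ∣ f.b := by
      have : (2 : ℤ) ∣ f.b ^ 2 := ⟨2 * f.a * f.c + 2 * -(p : ℤ), by linarith⟩
      exact Int.Prime.dvd_pow' Nat.prime_two this
    obtain ⟨a₁, ha₁⟩ : (2 : ℤ) ∣ f.a := hba ▸ hb2
    have ha₁pos : 0 < a₁ := by omega
    have key : a₁ * (2 * f.c - a₁) = p := by nlinarith
    -- `a₁ = 1` or `2c - a₁ = 1`
    have hcases : a₁ = 1 ∨ 2 * f.c - a₁ = 1 := by
      by_contra hne
      push Not at hne
      have hv : 1 ≤ 2 * f.c - a₁ := by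
        by_contra hlt
        have : a₁ * (2 * f.c - a₁) ≤ 0 := by nlinarith
        have : (0 : ℤ) < p := by exact_mod_cast hp.pos
        omega
      exact not_prime_of_mul_eq (u := a₁) (v := 2 * f.c - a₁) (by omega) (by omega) key hp
    rcases hcases with h | h
    · -- `a = 2 = b`, `2c = p + 1`, `c` even: not primitive
      subst h
      have hc : 2 * f.c = p + 1 := by nlinarith
      have hc2 : (2 : ℤ) ∣ f.c := by
        have h4 : (4 : ℤ) ∣ (p : ℤ) + 1 := by
          have : ((p : ℤ) + 1) % 4 = 0 := by omega
          exact Int.dvd_of_emod_eq_zero this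
        obtain ⟨k, hk⟩ := h4
        exact ⟨k, by omega⟩
      exact h2unit (hprim ⟨1, by omega⟩ hb2 hc2)
    · -- `a₁ = p`: `a = 2p > c = (p+1)/2`
      have hcp : 2 * f.c = p + a₁ := by omega
      have : a₁ = p := by nlinarith
      subst this
      have : (2 : ℤ) ≤ p := by exact_mod_cast hp.two_le
      nlinarith
  · -- `a = c`: `(a - β)(a + β) = p`
    obtain ⟨β, hbβ, hd⟩ := exists_b_eq_two_mul hf.disc_eq
    rw [← hac] at hd
    have key : (f.a - β) * (f.a + β) = p := by nlinarith
    have hβpos : 0 < β := by omega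
    have hβa : 2 * β ≤ f.a := by
      have : |f.b| = f.b := abs_of_pos hb0
      omega
    have hcases : f.a - β = 1 := by
      by_contra hne
      exact not_prime_of_mul_eq (u := f.a - β) (v := f.a + β) (by omega) (by omega) key hp
    have hsum : f.a + β = p := by rw [hcases, one_mul] at key; exact key
    -- then `b = p - 1 ≤ a = (p + 1)/2` forces `p = 3`, `f = (2, 2, 2)`
    have hp3 : (p : ℤ) = 3 := by
      have : (3 : ℤ) ≤ p := by
        have := hp.two_le
        omega
      omega
    have ha2 : f.a = 2 := by omega
    have hb2' : f.b = 2 := by omega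
    exact h2unit (hprim ⟨1, by omega⟩ ⟨1, by omega⟩ ⟨1, by omega⟩)

/-- **`C(ℤ[√-p])` has no element of order `2`** for a prime `p ≡ 3 (mod 4)`: a class equal to its
inverse is trivial. With `f = (a, b, c)` the label of `C` (Cox Thm. 7.7), the opposite form
`(a, -b, c)` has class `C⁻¹ = C`; if it is reduced then it equals `f` (uniqueness of reduced
forms), so `b = 0`, `ac = p`, `f = (1, 0, p)` is the principal form; otherwise `f` is on the
boundary of Lemma 3.10, excluded by `not_boundary_of_isLabel_neg_prime`. This is the case
`D = -4p`, `μ = r = 1` of Cox, Prop. 3.11: exactly `2^{μ-1} = 1` class of order `≤ 2`.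
[cite: Cox2013, §3.B Lemma 3.10 and Prop. 3.11] -/
theorem eq_one_of_inv_eq_self {p : ℕ} (hp : p.Prime) (hp4 : p % 4 = 3) [IsDomain (ℤ√(-(p : ℤ)))]
    {C : ClassGroup (ℤ√(-(p : ℤ)))} (hC : C⁻¹ = C) : C = 1 := by
  have hd : (-(p : ℤ)) < 0 := by have := hp.pos; omega
  set f : BinQF := ofClass (-(p : ℤ)) C with hfdef
  obtain ⟨hfl, hfC⟩ := isLabel_ofClass_and cox_formClassGroup_holds hd C
  rw [← hfdef] at hfl hfC
  obtain ⟨hfp, hfr⟩ := hfl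
  have hgp : (⟨f.a, -f.b, f.c⟩ : BinQF).IsPosPrim (4 * -(p : ℤ)) := isPosPrim_neg_b hfp
  have hgC : toClass (-(p : ℤ)) ⟨f.a, -f.b, f.c⟩ = C := by rw [toClass_neg_b hfp, hfC, hC]
  rcases isReduced_neg_b_or hfr with hgr | ⟨hb0, hbd⟩
  · -- the opposite form is a label of the same class: `b = 0`, `ac = p`, `f = (1, 0, p)`
    have hfg : (⟨f.a, -f.b, f.c⟩ : BinQF) = f :=
      eq_of_toClass_eq cox_formClassGroup_holds hd ⟨hgp, hgr⟩ ⟨hfp, hfr⟩ (hgC.trans hfC.symm)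
    have hb : f.b = 0 := by
      have := congrArg BinQF.b hfg
      simp only at this
      omega
    have hdisc := hfp.disc_eq
    simp only [disc, hb] at hdisc
    have hac : f.a * f.c = p := by linarith
    have ha := hfp.a_pos
    obtain ⟨-, hle, -⟩ := hfr
    have ha1 : f.a = 1 := by
      by_contra hne
      have hc2 : 2 ≤ f.c := by omega
      exact not_prime_of_mul_eq (u := f.a) (v := f.c) (by omega) hc2 hac hp
    have hfpr : f = principalForm (-(p : ℤ)) := by
      have hc : f.c = p := by rw [ha1, one_mul] at hac; exact hac
      rw [principalForm]
      ext
      · exact ha1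
      · exact hb
      · rw [hc, neg_neg]
    rw [← hfC, hfpr, toClass_principalForm]
  · exact (not_boundary_of_isLabel_neg_prime hp hp4 hfp hfr hb0 hbd).elim

/-- **The class number `h(-4p) = #C(ℤ[√-p])` is odd** for a prime `p ≡ 3 (mod 4)` (Cox,
Prop. 3.11 with Thm. 7.7: `2^{μ-1} = 1` class of order `≤ 2`; by Cauchy's theorem a group of even
order has an element of order `2`). [cite: Cox2013, §3.B Prop. 3.11] -/
theorem odd_card_classGroup_neg_prime {p : ℕ} (hp : p.Prime) (hp4 : p % 4 = 3)
    [IsDomain (ℤ√(-(p : ℤ)))] : Odd (Nat.card (ClassGroup (ℤ√(-(p : ℤ))))) := by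
  have hd : (-(p : ℤ)) < 0 := by have := hp.pos; omega
  have hcard := card_classGroup_eq_classNumber (d := -(p : ℤ)) cox_formClassGroup_holds hd
  have hpos : 0 < Nat.card (ClassGroup (ℤ√(-(p : ℤ)))) := by
    rw [hcard]
    exact classNumber_pos (by omega) (Or.inl (by omega))
  haveI : Finite (ClassGroup (ℤ√(-(p : ℤ)))) := Nat.finite_of_card_ne_zero hpos.ne'
  by_contra hodd
  rw [Nat.not_odd_iff_even, even_iff_two_dvd] at hodd
  haveI : Fact (Nat.Prime 2) := ⟨Nat.prime_two⟩
  obtain ⟨x, hx⟩ := exists_prime_orderOf_dvd_card' 2 hodd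
  have hx2 : x ^ 2 = 1 := by rw [← hx, pow_orderOf_eq_one]
  have hinv : x⁻¹ = x := by
    rw [inv_eq_iff_mul_eq_one, ← sq, hx2]
  have h1 := eq_one_of_inv_eq_self hp hp4 hinv
  rw [h1, orderOf_one] at hx
  exact absurd hx (by norm_num)

/-! ### A bound for the class number -/

omit [IsDomain (ℤ√d)] in
/-- `bndAux n k ≤ k`. [folklore] -/
theorem bndAux_le (n k : ℕ) : bndAux n k ≤ k := by
  induction k with
  | zero => simp [bndAux]
  | succ k ih =>
    simp only [bndAux]
    split_ifs
    · exact le_rfl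
    · exact ih.trans (Nat.le_succ k)

omit [IsDomain (ℤ√d)] in
/-- `redBound D ≤ |D|`. [folklore] -/
theorem redBound_le (D : ℤ) : redBound D ≤ D.natAbs := bndAux_le _ _

omit [IsDomain (ℤ√d)] in
/-- The number of candidates is `(redBound D + 1)(2 redBound D + 1)`. [folklore] -/
theorem length_candidatesList (D : ℤ) :
    (candidatesList D).length = (redBound D + 1) * (2 * redBound D + 1) := by
  rw [candidatesList, List.length_flatMap]
  simp only [List.length_map, List.length_range, List.map_const', List.sum_replicate,
    smul_eq_mul]

omit [IsDomain (ℤ√d)] in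
/-- **Crude class number bound**: `h(D) ≤ (redBound D + 1)(2 redBound D + 1) ≤ (|D|+1)(2|D|+1)`
(every reduced form is among the candidates). [folklore] -/
theorem classNumber_le (D : ℤ) : classNumber D ≤ (D.natAbs + 1) * (2 * D.natAbs + 1) := by
  rw [classNumber, reducedFormsList]
  refine (List.length_filter_le _ _).trans ?_
  rw [length_candidatesList]
  have := redBound_le D
  exact Nat.mul_le_mul (by omega) (by omega)

/-- `#C(ℤ[√d]) ≤ (4|d| + 1)(8|d| + 1)` for `d < 0` (Cox Thm. 7.7: `#C(ℤ[√d]) = h(4d)`, and the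
crude bound `classNumber_le`). [cite: Cox2013, §7.B Thm. 7.7(ii)] -/
theorem card_classGroup_zsqrtd_le (hd : d < 0) :
    Nat.card (ClassGroup (ℤ√d)) ≤ (4 * d.natAbs + 1) * (2 * (4 * d.natAbs) + 1) := by
  rw [card_classGroup_eq_classNumber cox_formClassGroup_holds hd]
  have h := classNumber_le (4 * d)
  have e : (4 * d).natAbs = 4 * d.natAbs := by rw [Int.natAbs_mul]; rfl
  rwa [e] at h

end Literature.NumberTheory.QuadraticFields.Quadratic.BinQF

end
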